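import Mathlib
import Literature.AlgebraicGeometry.RelativeSpec.FiniteGroupQuotientGluing

/-!
# Cyclic divisorial transfer — the stalk form of the divisorial hypothesis on a stable open

Stub `stub_stalkAug_restrict` of crux stmt-ResolutionOfSingularities-15640 (line `Sketch`):
for an action `ρ` of `G` on `X` over `Y`, a `G`-stable open `O ⊆ X` with the restricted action
`ρ.restrict O hO` (`Literature.AlgebraicGeometry.RelativeSpec.ActionOver.restrict`, whose
automorphisms are the restrictions `restrictHom g`, `restrictHom g ≫ O.ι = O.ι ≫ g`), and a point
`x ∈ O` fixed by `g`: if the augmentation ideal `(a s - s : s)` of the stalk action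
`a = stalkSpecializes ≫ g.stalkMap x` on `𝒪_{X,x}` is principal, then so is the augmentation ideal of
the stalk action of `restrictHom g` on `𝒪_{O,x}`.  The stalk isomorphism `𝒪_{X,x} ≅ 𝒪_{O,x}`
(`O.ι.stalkMap x`, `Scheme.Opens.stalkIso`) intertwines the two stalk actions (checked on germs),
and principality of the span of `{a s - s}` is transported along an intertwining ring isomorphism.
-/

set_option linter.dupNamespace false

noncomputable section

open CategoryTheory Limits AlgebraicGeometry TopologicalSpace
open Literature.AlgebraicGeometry.Resolution Literature.AlgebraicGeometry.RelativeSpec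

namespace Summit.ResolutionOfSingularities.ResolutionOfSingularities.Theorems.WildQuotientResolution.CyclicTransfer

/-- Transport of principality of an augmentation ideal `(a s - s : s)` along a ring isomorphism
`e` intertwining `a` on `R` with `a'` on `S`. -/
theorem isPrincipal_span_range_sub_of_ringEquiv {R S : Type*} [CommRing R] [CommRing S]
    (e : R ≃+* S) (a : R → R) (a' : S → S) (he : ∀ s, e (a s) = a' (e s))
    (h : (Ideal.span (Set.range fun s => a s - s)).IsPrincipal) :
    (Ideal.span (Set.range fun s => a' s - s)).IsPrincipal := by
  have key : (Ideal.span (Set.range fun s => a s - s)).map (e : R →+* S) =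
      Ideal.span (Set.range fun s => a' s - s) := by
    rw [Ideal.map_span, ← Set.range_comp]
    congr 1
    ext t
    simp only [Set.mem_range, Function.comp_apply, RingHom.coe_coe, map_sub, he]
    constructor
    · rintro ⟨s, rfl⟩
      exact ⟨e s, rfl⟩
    · rintro ⟨s, rfl⟩
      exact ⟨e.symm s, by rw [e.apply_symm_apply]⟩
  rw [← key]
  exact h.map_ringHom _

/-- For a commuting square `γ' ≫ j = j ≫ γ` of scheme morphisms and a point `z` fixed by `γ'`
(so that `j z` is fixed by `γ`), the stalk map of `j` at `z` intertwines the stalk action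
`stalkSpecializes ≫ γ.stalkMap (j z)` of `γ` on `𝒪_{Z, j z}` with the stalk action of `γ'` on
`𝒪_{Z', z}`. -/
theorem stalkAct_comp_stalkMap {Z Z' : Scheme.{0}} (j : Z' ⟶ Z) (γ : Z ⟶ Z) (γ' : Z' ⟶ Z')
    (H : γ' ≫ j = j ≫ γ) (z : Z') (hz' : γ'.base z = z) (hz : γ.base (j.base z) = j.base z) :
    (Z.presheaf.stalkSpecializes (specializes_of_eq hz) ≫ γ.stalkMap (j.base z)) ≫
        j.stalkMap z =
      j.stalkMap z ≫ Z'.presheaf.stalkSpecializes (specializes_of_eq hz') ≫ γ'.stalkMap z := by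
  apply TopCat.Presheaf.stalk_hom_ext
  intro U hU
  simp only [Category.assoc, TopCat.Presheaf.germ_stalkSpecializes_assoc,
    Scheme.Hom.germ_stalkMap_assoc, Scheme.Hom.germ_stalkMap]
  simp only [← Scheme.Hom.appLE_eq_app, Scheme.Hom.appLE_comp_appLE_assoc, H]
  simp [Scheme.Hom.appLE]

/-- STUB `stub_stalkAug_restrict` (S–M, classical): **the stalk form of the divisorial hypothesis
descends to a `G`-stable open subscheme.** For a `G`-stable open `O ⊆ X`, a point `x ∈ O` fixed by
`g`, and the restricted action `ρ.restrict O hO` (whose automorphisms are the restrictions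
`restrictHom`, `restrictHom_ι`): the stalk isomorphism `𝒪_{O,x} ≅ 𝒪_{X,x}` (`O.ι.stalkMap`)
intertwines the two stalk actions of `g`, so principality of the augmentation ideal transfers.
[folklore] -/
theorem stub_stalkAug_restrict {X Y : Scheme.{0}} {r : X ⟶ Y} {G : Type} [Group G]
    (ρ : ActionOver r G) (O : X.Opens) (hO : ∀ g : G, (ρ.aut g).hom ⁻¹ᵁ O = O) (g : G)
    (x : O) (hgx : (ρ.aut g).hom.base x.1 = x.1)
    (hdiv : (Ideal.span (Set.range fun s : X.presheaf.stalk x.1 =>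
        (X.presheaf.stalkSpecializes (specializes_of_eq hgx) ≫ (ρ.aut g).hom.stalkMap x.1).hom s -
          s)).IsPrincipal) :
    ∃ hgx' : ((ρ.restrict O hO).aut g).hom.base x = x,
      (Ideal.span (Set.range fun s : (O : Scheme.{0}).presheaf.stalk x =>
        ((O : Scheme.{0}).presheaf.stalkSpecializes (specializes_of_eq hgx') ≫
          ((ρ.restrict O hO).aut g).hom.stalkMap x).hom s - s)).IsPrincipal := by
  have hgx' : ((ρ.restrict O hO).aut g).hom.base x = x := by
    apply Subtype.ext
    have h1 := ρ.ι_restrictHom_apply O hO g x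
    simp only [Scheme.Opens.ι_apply] at h1
    rw [ActionOver.restrict_aut_hom]
    exact h1.trans hgx
  refine ⟨hgx', ?_⟩
  have sq := stalkAct_comp_stalkMap O.ι (ρ.aut g).hom ((ρ.restrict O hO).aut g).hom
    (by rw [ActionOver.restrict_aut_hom, ActionOver.restrictHom_ι]) x hgx' hgx
  have he : ∀ s, (O.stalkIso x).symm.commRingCatIsoToRingEquiv s = (O.ι.stalkMap x).hom s :=
    fun s => by rw [← Scheme.Opens.stalkIso_inv]; rfl
  refine isPrincipal_span_range_sub_of_ringEquiv (O.stalkIso x).symm.commRingCatIsoToRingEquiv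
    _ _ (fun s => ?_) hdiv
  have := DFunLike.congr_fun (CommRingCat.hom_ext_iff.mp sq) s
  simp only [CommRingCat.hom_comp] at this
  rw [he, he]
  exact this

end Summit.ResolutionOfSingularities.ResolutionOfSingularities.Theorems.WildQuotientResolution.CyclicTransfer

end
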